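import Literature.MathematicalPhysics.QuantumFieldTheory.Balaban1983to89.B9Eq358Decomposition
import Literature.MathematicalPhysics.QuantumFieldTheory.Balaban1983to89.B7Prop6Bound
import Literature.MathematicalPhysics.QuantumFieldTheory.Balaban1983to89.B9Eq3113Proof

/-!
# `Balaban1983to89.B9Eq357Levels` — T. Bałaban, *Propagators for lattice gauge theories in a background field*,
Commun. Math. Phys. **99** (1985) 389–434 [Balaban1985BackgroundPropagators]: (3.55)–(3.57) p. 401 — the structure of
`(U′U)(Γ^{(j)}_{y,x})(U(Γ^{(j)}_{y,x}))⁻¹` through the levels, EXACTLY, and the key estimate of p. 401 behind (3.58) from its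
printed per-level inputs ([5] (161)–(163)), uniform in `j`

statement-level skeleton of published theorems with citation tags; proofs where landed; nothing here is a claim about the Yang–Mills mass gap

PDF held: `paper:balaban1985-cmp99-background-propagators` (journal page = PDF page + 388; p. 401 = render
`b2b-balaban-ref1/pages/1985-cmp99-background-propagators/…-p013-x2.png`, READ AS AN IMAGE); [5] = [Balaban1985Averaging].

CITATION HEADER / WHAT IS REPRODUCED.  SKELETON row **B9.Eq3.58** (file 2 of 2; file 1 = `B9Eq358Decomposition`: objects,
the decomposition, (3.58)–(3.59) from the key estimate, `j = 1`), cell `lit-balaban` (HOME `run/shared/lean/pub/lit-balaban/`),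
seat p06 = unit `lit-balaban-p06`.  p. 401 [PDF 13], verbatim: *"We apply the identity (97) [5] (Ũ′^l)(x,x′) =
v_l(x)(U̿′^l)(x,x′)R(Ū^l(x,x′))v_l⁻¹(x′), (3.56) where v_l(x) is given by (160). Using (102), (103) we get (U′U)(Γ^{(j)}_{y,x}) =
v_j(y)·Π_{l=j−1}^{0} R(Ū^{l+1}(Γ^{(j−l−1)}_{y,x_{l+1}}))·[(\overline{R̄^l_{x_{l+1}}U̿′^l})⁻¹(R̄^l_{x_{l+1}}U̿′^l)(Γ_{x_{l+1},x_l})]·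
U(Γ^{(j)}_{y,x}). (3.57) … Applying the inequalities (161), (162) [5], we have (1/i) log U̿′^l = Q_l(U, ξA′), |Q_l(U, ξA′)| <
2α₁L^lξ, |(1/i) log(\overline{R̄^l_{x_{l+1}}U̿′^l})| < O(1)α₁L^{l+1}ξ, |v_j(y) − 1| < O(1)α₁ for α₁ sufficiently small. By
Proposition 4 [5] the expression on the right-hand side of (3.57) is an analytic function of A, and by the above bounds
|(U′U)(Γ^{(j)}_{y,x})(U(Γ^{(j)}_{y,x}))⁻¹ − 1| < O(1)α₁."*
CARRIERS (REUSED BY NAME): file 1's `compT` (3.55)/(53), `pFac`, `bsite`, `FpOp`, `QpAbs`; `B7Eq92Concrete.tildIter` (69),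
`dbavgCovIter` (91), `vcov` (97)/(160), `wframe` (82), `tHol` (58), `tildIter_eq_mgauge` ((97) = (3.56)), `vcov_succ` ((102)–(103));
`B8Eq115GaugeFixing.tg`; `B7Prop6Bound` (the arithmetic (162) ⇒ (163)).  NEW objects: the level bookkeeping `bgPart`/`prPart`
(partial composite transporters of the two towers), `frame` (`\overline{R̄^lU̿′^l}`), `twist` (`(R̄^lU̿′^l)(Γ_{x_{l+1},x_l})`), `qFac`
(`P` at depth `n` with the dangling `v_{j−n}` of (3.56) absorbed), `tgS` (the tower gauge function `tg` below its top
factor = the lower factors of (3.55)), `splitIdx` (`B^{j+1}(y) = ⋃_{x_j∈B(Ly)}B^j(x_j)` on offsets).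
WHAT THIS FILE PROVES (kernel, 0 sorry, axioms ⊆ {propext, Classical.choice, Quot.sound}): `axialFn_avgIter_mul` — one level
of (3.55) with (3.56) inserted; **`qFac_succ`** — (3.57) as an EXACT recursion `Q_{n+1}(x) = Q_n(x_{n+1})·R(Ū‑part)[frame⁻¹·twist]`
(the `v_l` at the junction of two levels leave exactly `(\overline{R̄^lU̿′^l})⁻¹`), `qFac_zero` (prefactor `v_j(y)`), `qFac_top`
(`v_0 = 1`); **`norm_pFac_sub_one_le`** — `|P − 1| ≤ (1 + δ_v)Π_{l<j}(1 + δ_l) − 1` from per-level bounds `δ_l` on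
`frame⁻¹·twist` and `|v_j(y) − 1| ≤ δ_v`, for `x ∈ B^j(y)` and a unit-bounded background tower; **`norm_pFac_sub_one_le_explicit`**
— with the PRINTED shapes `δ_l = cα₁L^{l+1}ξ` (`ξ = L^{−j}`; (161)–(162)) and `δ_v = c′α₁` ((163)), `L ≥ 2`:
`|P − 1| ≤ (1 + c′α₁)e^{2cα₁} − 1`, an `O(1)α₁` UNIFORM in `j`; `norm_FpOp_le_explicit` — (3.58)–(3.59) with that constant;
§5 **`QpC_eq_QpIter`** — the second equality of (3.19) p. 393, `Q′(Ū^{j−1})⋯Q′(U)λ = Σ_{x∈B^j(y)}L^{−jd}R(U(Γ^{(j)}_{y,x}))λ(x)`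
(`B9Eq3113Proof.QpIter = QpC`), by (3.55) peeled from the top (`compT_succ_top`) and the block index split (`splitIdx`).
HYPOTHESES LEFT AS PRINTED INPUTS: (161) = [5] Prop. 4 (131) and (162), (163) = [5] (162)–(163) at a GENERAL background are the
binders `hδ`, `hv` — the tree has them only conditionally (`B7Prop4GeneralLevels.prop4_general_of_prop3`) resp. as arithmetic
(`B7Prop6Bound.ineq163_explicit`); HOME/GAPS.md G-B9-p06-1.  NOT HERE: Prop. 4's analyticity clause for (3.57).
-/

noncomputable section

open scoped BigOperators
open NormedSpace Finset

namespace Literature.MathematicalPhysics.QuantumFieldTheory.Balaban1983to89.B9Eq357Levels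

open B7Prop1Explicit B7Prop2Explicit B7Prop3Flat B7Eq92Concrete MatrixLog B7Prop3GeneralAnalytic B8Eq115GaugeFixing
  B9Eq358Decomposition
open B8Ineq130 (fl)
open B7Eq78Linearization (conjR conjR_apply conjR_one conjR_add conjR_sub conjR_smul)
open B7Prop3GeneralRotated (conjR_mul_left norm_conjR_le)
open B7Prop6Bound (mul_sub_one_norm_le prod_one_add_le_exp_sum geom_tail_le)

-- `Site` alone would resolve to the torus sites of `Setup.lean`; re-export the `ℤ^d` sites of `B7Prop1Explicit`.
export B7Prop1Explicit (Site)

variable {d : ℕ}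
variable {𝔸 : Type*} [NormedRing 𝔸] [NormedAlgebra ℂ 𝔸] [CompleteSpace 𝔸]

/-! ## §3 (3.55)–(3.57): the structure of `P` through the levels ([5] (97) = (3.56), frames (102)–(103)) -/

section Levels

variable (L : ℕ) (U U' : Site d → Fin d → 𝔸ˣ) (j : ℕ) (y : Site d)

/-- the depth-`n` partial transporter `Ū^{l+1}(Γ^{(j−l−1)}_{y,x_{l+1}})` of the BACKGROUND tower (`n = j − l − 1`; the
rotations `R(Ū^{l+1}(Γ^{(j−l−1)}_{y,x_{l+1}}))` of (3.57)). [cite: Balaban1985BackgroundPropagators, (3.57) p.401] -/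
def bgPart (n : ℕ) (z : Site d) : 𝔸ˣ := tg L (fun l => avgIter L U l) j y n z

/-- the same for the tower of the PRODUCT `U′U` ((3.55)). [cite: Balaban1985BackgroundPropagators, (3.55) p.401] -/
def prPart (n : ℕ) (z : Site d) : 𝔸ˣ := tg L (fun l => avgIter L (U' * U) l) j y n z

/-- the level-`l` block frame `\overline{R̄^l_{x}U̿′^l}` of (3.57) ([5] (82)/(85) at the background `Ū^l`, `B7Eq92Concrete.wframe`
of the `l`-fold double-bar average `U̿′^l = dbavgCovIter L U U′ l`). [cite: Balaban1985BackgroundPropagators, (3.57) p.401] -/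
def frame (l : ℕ) (s : Site d) : 𝔸ˣ := wframe L (avgIter L U l) (dbavgCovIter L U U' l) s

/-- the level-`l` twisted transport `(R̄^l_{x_{l+1}}U̿′^l)(Γ_{x_{l+1},x_l})` of (3.57) ([5] (58) at the background `Ū^l`, along
the block contour from the corner `Lx_{l+1}` to `x_l`). [cite: Balaban1985BackgroundPropagators, (3.57) p.401] -/
def twist (l : ℕ) (x : Site d) : 𝔸ˣ :=
  tHol (avgIter L U l) (dbavgCovIter L U U' l) ((L : ℤ) • fl L x) (treeWord (x - (L : ℤ) • fl L x))

/-- the depth-`n` version of `P` with the dangling frame `v_{j−n}` of (3.56) absorbed: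
`Q_n(z) = (U′U)‑part · (U‑part)⁻¹ · R(U‑part)(v_{j−n}(z))`. [cite: Balaban1985BackgroundPropagators, (3.56)–(3.57) p.401] -/
def qFac (n : ℕ) (z : Site d) : 𝔸ˣ :=
  prPart L U U' j y n z * (bgPart L U j y n z)⁻¹ * Rc (bgPart L U j y n z) (vcov L U U' (j - n) z)

/-- at full depth the dangling frame is `v_0 = 1`: `Q_j(x) = P(y, x)`. [cite: Balaban1985BackgroundPropagators, (3.57) p.401] -/
theorem qFac_top (x : Site d) : qFac L U U' j y j x = pFac L U U' j y x := by
  rw [qFac, Nat.sub_self, vcov_zero, map_one, mul_one]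
  rfl

/-- at depth `0` and the top site `y` itself: `Q_0(y) = v_j(y)` — the prefactor of (3.57). [cite: Balaban1985BackgroundPropagators, (3.57) p.401] -/
theorem qFac_zero : qFac L U U' j y 0 y = vcov L U U' j y := by
  simp [qFac, prPart, bgPart, tg_zero, axialFn_self]

/-- **(3.55)–(3.56) for one level** — the product tower's block transporter splits off the background's:
`\overline{(U′U)}^l(Γ_{Lz,x}) = v_l(Lz)·(R̄^l_{Lz}U̿′^l)(Γ_{Lz,x})·[R(Ū^l(Γ_{Lz,x}))v_l(x)]⁻¹·Ū^l(Γ_{Lz,x})`, by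
`\overline{U′U}^l = Ũ′^lŪ^l` ([5] (69)) and (3.56) = [5] (97) `Ũ′^l = (U̿′^l)^{v_l}` (`B7Eq92Concrete.tildIter_eq_mgauge`) with the
covariance of the twisted transport (`tHol_mgauge`). [cite: Balaban1985BackgroundPropagators, (3.55)–(3.56) p.401] -/
theorem axialFn_avgIter_mul (l : ℕ) (x : Site d) :
    axialFn (avgIter L (U' * U) l) ((L : ℤ) • fl L x) x
      = vcov L U U' l ((L : ℤ) • fl L x) * twist L U U' l x
          * (Rc (axialFn (avgIter L U l) ((L : ℤ) • fl L x) x) (vcov L U U' l x))⁻¹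
          * axialFn (avgIter L U l) ((L : ℤ) • fl L x) x := by
  have hmul : avgIter L (U' * U) l = tildIter L U U' l * avgIter L U l := (tildIter_mul L U U' l).symm
  have hx : (L : ℤ) • fl L x + disp (treeWord (x - (L : ℤ) • fl L x)) = x := by rw [disp_treeWord, add_sub_cancel]
  rw [axialFn, hmul, show hol (tildIter L U U' l * avgIter L U l) ((L : ℤ) • fl L x) (treeWord (x - (L : ℤ) • fl L x))
      = tHol (avgIter L U l) (tildIter L U U' l) ((L : ℤ) • fl L x) (treeWord (x - (L : ℤ) • fl L x))
        * hol (avgIter L U l) ((L : ℤ) • fl L x) (treeWord (x - (L : ℤ) • fl L x)) by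
      rw [tHol, inv_mul_cancel_right], tildIter_eq_mgauge L U U' l, tHol_mgauge, hx, twist, axialFn]

/-- **(3.57), the recursion through one level**: `Q_{n+1}(x) = Q_n(x_{n+1})·R(Ū‑part)[(\overline{R̄^lU̿′^l})(Lx_{n+1})⁻¹·
(R̄^l_{x_{n+1}}U̿′^l)(Γ_{x_{n+1},x})]`, `l = j − n − 1`, `x_{n+1} = fl L x` — the frames `v_l` of (3.56) at the junction of two
levels leave exactly the inverse block frame, by [5] (102)–(103) (`vcov_succ`: `v_{l+1}(z) = v_l(Lz)·\overline{R̄^l_{Lz}U̿′^l}`).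
[cite: Balaban1985BackgroundPropagators, (3.57) p.401] -/
theorem qFac_succ (n : ℕ) (hn : n + 1 ≤ j) (x : Site d) :
    qFac L U U' j y (n + 1) x
      = qFac L U U' j y n (fl L x)
        * Rc (bgPart L U j y n (fl L x)) ((frame L U U' (j - (n + 1)) ((L : ℤ) • fl L x))⁻¹ * twist L U U' (j - (n + 1)) x) := by
  have hl : j - n = (j - (n + 1)) + 1 := by omega
  have hv : vcov L U U' (j - n) (fl L x)
      = vcov L U U' (j - (n + 1)) ((L : ℤ) • fl L x) * frame L U U' (j - (n + 1)) ((L : ℤ) • fl L x) := by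
    rw [hl, vcov_succ, frame]
  rw [qFac, qFac, prPart, bgPart, tg_succ, tg_succ, axialFn_avgIter_mul, hv]
  simp only [prPart, bgPart, Rc_apply, mul_inv_rev, inv_inv]
  group

/-- iterated blocks: `x_n = (fl L)^{[n]} x`. [folklore] -/
private theorem iterate_fl_succ (n : ℕ) (x : Site d) : (fl L)^[n + 1] x = (fl L)^[n] (fl L x) :=
  Function.iterate_succ_apply (fl L) n x

variable [NormOneClass 𝔸]

/-- **the telescoping bound behind *"by the above bounds |(U′U)(Γ^{(j)}_{y,x})(U(Γ^{(j)}_{y,x}))⁻¹ − 1| < O(1)α₁"*** (p. 401):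
if the background tower is unit-bounded and every level-`l` factor of (3.57) satisfies
`|(\overline{R̄^lU̿′^l})⁻¹(R̄^lU̿′^l)(Γ) − 1| ≤ δ_l`, then `|Q_n(x) − 1| ≤ (1 + |Q_0(x_n) − 1|)·Π_{m<n}(1 + δ_{j−1−m}) − 1`.
[cite: Balaban1985BackgroundPropagators, (3.57)–(3.58) p.401] -/
theorem norm_qFac_sub_one_le (hU : ∀ l ≤ j, ∀ x κ, avgIter L U l x κ ∈ U1 𝔸) {δ : ℕ → ℝ} (hδ0 : ∀ l, 0 ≤ δ l)
    (hδ : ∀ l < j, ∀ x : Site d,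
      ‖((((frame L U U' l ((L : ℤ) • fl L x))⁻¹ * twist L U U' l x : 𝔸ˣ) : 𝔸)) - 1‖ ≤ δ l) :
    ∀ (n : ℕ), n ≤ j → ∀ x : Site d,
      ‖((qFac L U U' j y n x : 𝔸ˣ) : 𝔸) - 1‖
        ≤ (1 + ‖((qFac L U U' j y 0 ((fl L)^[n] x) : 𝔸ˣ) : 𝔸) - 1‖) * (∏ m ∈ range n, (1 + δ (j - 1 - m))) - 1
  | 0, _, x => by simp
  | n + 1, hn, x => by
      have ih := norm_qFac_sub_one_le hU hδ0 hδ n (by omega) (fl L x)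
      have hG : bgPart L U j y n (fl L x) ∈ U1 𝔸 :=
        tg_mem (S := U1 𝔸) (fun l hl => hU l hl) y n (fl L x)
      have hc := hδ (j - (n + 1)) (by omega) x
      rw [qFac_succ L U U' j y n hn x, Units.val_mul, iterate_fl_succ, Finset.prod_range_succ,
        show j - 1 - n = j - (n + 1) by omega]
      have hR : ‖((Rc (bgPart L U j y n (fl L x))
            ((frame L U U' (j - (n + 1)) ((L : ℤ) • fl L x))⁻¹ * twist L U U' (j - (n + 1)) x) : 𝔸ˣ) : 𝔸) - 1‖
          ≤ δ (j - (n + 1)) := by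
        rw [Rc_apply, Units.val_mul, Units.val_mul]
        exact (norm_units_conj_sub_one_le hG _).trans hc
      have hA : 0 ≤ 1 + ‖((qFac L U U' j y 0 ((fl L)^[n] (fl L x)) : 𝔸ˣ) : 𝔸) - 1‖ := by positivity
      have hP : 0 ≤ ∏ m ∈ range n, (1 + δ (j - 1 - m)) := Finset.prod_nonneg fun m _ => by linarith [hδ0 (j - 1 - m)]
      calc _ ≤ (1 + ‖((qFac L U U' j y n (fl L x) : 𝔸ˣ) : 𝔸) - 1‖)
              * (1 + ‖((Rc (bgPart L U j y n (fl L x))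
                  ((frame L U U' (j - (n + 1)) ((L : ℤ) • fl L x))⁻¹ * twist L U U' (j - (n + 1)) x) : 𝔸ˣ) : 𝔸) - 1‖) - 1 :=
            mul_sub_one_norm_le _ _
        _ ≤ ((1 + ‖((qFac L U U' j y 0 ((fl L)^[n] (fl L x)) : 𝔸ˣ) : 𝔸) - 1‖) * (∏ m ∈ range n, (1 + δ (j - 1 - m))))
              * (1 + δ (j - (n + 1))) - 1 := by
            have h1 : 1 + ‖((qFac L U U' j y n (fl L x) : 𝔸ˣ) : 𝔸) - 1‖
                ≤ (1 + ‖((qFac L U U' j y 0 ((fl L)^[n] (fl L x)) : 𝔸ˣ) : 𝔸) - 1‖) * ∏ m ∈ range n, (1 + δ (j - 1 - m)) := by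
              linarith
            have h2 := hR
            nlinarith [norm_nonneg (((qFac L U U' j y n (fl L x) : 𝔸ˣ) : 𝔸) - 1),
              norm_nonneg ((((Rc (bgPart L U j y n (fl L x))
                  ((frame L U U' (j - (n + 1)) ((L : ℤ) • fl L x))⁻¹ * twist L U U' (j - (n + 1)) x) : 𝔸ˣ) : 𝔸)) - 1),
              mul_nonneg hA hP, hδ0 (j - (n + 1))]
        _ = _ := by ring

/-- **the key estimate of p. 401 from its printed inputs**: for `x ∈ B^j(y)` (`(fl L)^{[j]}x = y`), a unit-bounded background
tower, per-level bounds `δ_l` on the factors of (3.57) (print: (161)–(162) of [5], `O(1)α₁L^{l+1}ξ`) and `|v_j(y) − 1| ≤ δ_v`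
(print: [5] (163), `O(1)α₁`): `|(U′U)(Γ^{(j)}_{y,x})(U(Γ^{(j)}_{y,x}))⁻¹ − 1| ≤ (1 + δ_v)·Π_{l<j}(1 + δ_l) − 1`.
[cite: Balaban1985BackgroundPropagators, p.401 (3.57)–(3.58)] -/
theorem norm_pFac_sub_one_le (hU : ∀ l ≤ j, ∀ x κ, avgIter L U l x κ ∈ U1 𝔸) {δ : ℕ → ℝ} (hδ0 : ∀ l, 0 ≤ δ l)
    (hδ : ∀ l < j, ∀ x : Site d,
      ‖((((frame L U U' l ((L : ℤ) • fl L x))⁻¹ * twist L U U' l x : 𝔸ˣ) : 𝔸)) - 1‖ ≤ δ l)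
    {δv : ℝ} (hv : ‖((vcov L U U' j y : 𝔸ˣ) : 𝔸) - 1‖ ≤ δv) {x : Site d} (hx : (fl L)^[j] x = y) :
    ‖((pFac L U U' j y x : 𝔸ˣ) : 𝔸) - 1‖ ≤ (1 + δv) * (∏ l ∈ range j, (1 + δ l)) - 1 := by
  have h := norm_qFac_sub_one_le L U U' j y hU hδ0 hδ j le_rfl x
  rw [qFac_top, hx, qFac_zero] at h
  have hP : 0 ≤ ∏ m ∈ range j, (1 + δ (j - 1 - m)) := Finset.prod_nonneg fun m _ => by linarith [hδ0 (j - 1 - m)]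
  have hprod : ∏ m ∈ range j, (1 + δ (j - 1 - m)) = ∏ l ∈ range j, (1 + δ l) :=
    Finset.prod_range_reflect (fun l => 1 + δ l) j
  calc _ ≤ (1 + ‖((vcov L U U' j y : 𝔸ˣ) : 𝔸) - 1‖) * (∏ m ∈ range j, (1 + δ (j - 1 - m))) - 1 := h
    _ ≤ (1 + δv) * (∏ m ∈ range j, (1 + δ (j - 1 - m))) - 1 := by
        have := mul_le_mul_of_nonneg_right (add_le_add_left hv 1) hP; linarith
    _ = _ := by rw [hprod]

/-- **… with the printed shapes of the inputs** ([5] (161)–(163) as used on p. 401: `δ_l = cα₁L^{l+1}ξ`, `ξ = L^{−j}`,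
`δ_v = c′α₁`, `L ≥ 2`): `|P − 1| ≤ (1 + c′α₁)e^{2cα₁} − 1` — an `O(1)α₁` uniform in `j` (the geometric sum `Σ_{l<j}L^{l+1−j} ≤ 2`,
`B7Prop6Bound.geom_tail_le`). [cite: Balaban1985BackgroundPropagators, p.401 (3.57)–(3.58)] -/
theorem norm_pFac_sub_one_le_explicit (hL : 2 ≤ L) (hU : ∀ l ≤ j, ∀ x κ, avgIter L U l x κ ∈ U1 𝔸) {c c' α₁ : ℝ}
    (hc : 0 ≤ c) (hα : 0 ≤ α₁)
    (hδ : ∀ l < j, ∀ x : Site d,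
      ‖((((frame L U U' l ((L : ℤ) • fl L x))⁻¹ * twist L U U' l x : 𝔸ˣ) : 𝔸)) - 1‖
        ≤ c * α₁ * ((L : ℝ) ^ (l + 1) / (L : ℝ) ^ j))
    (hv : ‖((vcov L U U' j y : 𝔸ˣ) : 𝔸) - 1‖ ≤ c' * α₁) {x : Site d} (hx : (fl L)^[j] x = y) :
    ‖((pFac L U U' j y x : 𝔸ˣ) : 𝔸) - 1‖ ≤ (1 + c' * α₁) * Real.exp (2 * c * α₁) - 1 := by
  have hLr : (2 : ℝ) ≤ L := by exact_mod_cast hL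
  have hδ0 : ∀ l, 0 ≤ c * α₁ * ((L : ℝ) ^ (l + 1) / (L : ℝ) ^ j) := fun l => by positivity
  have h := norm_pFac_sub_one_le L U U' j y hU hδ0 hδ hv hx
  have hsum : (∑ l ∈ range j, c * α₁ * ((L : ℝ) ^ (l + 1) / (L : ℝ) ^ j)) ≤ 2 * c * α₁ := by
    rw [← Finset.mul_sum]
    nlinarith [geom_tail_le (L : ℝ) hLr j, mul_nonneg hc hα]
  have hprod := (prod_one_add_le_exp_sum (fun l => c * α₁ * ((L : ℝ) ^ (l + 1) / (L : ℝ) ^ j)) j hδ0).trans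
    (Real.exp_le_exp.mpr hsum)
  have hv0 : 0 ≤ 1 + c' * α₁ := by linarith [norm_nonneg (((vcov L U U' j y : 𝔸ˣ) : 𝔸) - 1)]
  nlinarith [mul_le_mul_of_nonneg_left hprod hv0]

end Levels

/-! ## §4 (3.58)–(3.59) with the constant of p. 401's route -/

section Assembled

variable (L : ℕ) [NormOneClass 𝔸]

/-- **(3.58) ∧ (3.59) with the constant of p. 401's route**: unit-bounded towers, the per-level inputs (161)–(162) of [5] in the
shape `cα₁L^{l+1}ξ` and (163) `|v_j(y) − 1| ≤ c′α₁`, `L ≥ 2` ⇒ `|(F′_{2,j}(A)λ)(y)| ≤ 2((1 + c′α₁)e^{2cα₁} − 1)·(Q′_j|λ|)(y)`.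
[cite: Balaban1985BackgroundPropagators, (3.58)–(3.59) p.402] -/
theorem norm_FpOp_le_explicit (hL : 2 ≤ L) {U U' : Site d → Fin d → 𝔸ˣ} {j : ℕ}
    (hU : ∀ l ≤ j, ∀ x κ, avgIter L U l x κ ∈ U1 𝔸) (hU' : ∀ l ≤ j, ∀ x κ, avgIter L (U' * U) l x κ ∈ U1 𝔸)
    (lam : Site d → 𝔸) (y : Site d) {c c' α₁ : ℝ} (hc : 0 ≤ c) (hα : 0 ≤ α₁)
    (hδ : ∀ l < j, ∀ x : Site d,
      ‖((((frame L U U' l ((L : ℤ) • fl L x))⁻¹ * twist L U U' l x : 𝔸ˣ) : 𝔸)) - 1‖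
        ≤ c * α₁ * ((L : ℝ) ^ (l + 1) / (L : ℝ) ^ j))
    (hv : ‖((vcov L U U' j y : 𝔸ˣ) : 𝔸) - 1‖ ≤ c' * α₁) :
    ‖FpOp L U U' j lam y‖ ≤ 2 * ((1 + c' * α₁) * Real.exp (2 * c * α₁) - 1) * QpAbs L j lam y := by
  have h1 : (1 : ℕ) ≤ L := by omega
  exact norm_FpOp_le L hU hU' lam y fun r =>
    norm_pFac_sub_one_le_explicit L U U' j y hL hU hc hα hδ hv (iterate_fl_bsite L h1 j y r)

end Assembled


/-! ## §5 (3.19), second equality: `Q′_j = Q′(Ū^{j−1})⋯Q′(U)` IS the `B^j(y)`-average with the composite transporters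

p. 393 [PDF 5] (read on the render `…-p005-x2.png`), verbatim: *"(Q′_j(U)λ)(y) = (Q′(Ū^{j−1})·…·Q′(Ū)Q′(U)λ)(y) =
Σ_{x∈B^j(y)} L^{−jd}R(U(Γ^{(j)}_{y,x}))λ(x), y ∈ T^{(j)}_{L^jη}. (3.19) The contours Γ^{(j)}_{y,x}, x ∈ B^j(y), and the contour
variables U(Γ^{(j)}_{y,x}) were defined by (52), (53) in [5]."* (`η = 1` here; `U(Γ^{(j)}_{y,x})` = file 1's `compT`, (3.55)).  `B9Eq3113Proof.QpIter` is the composite (first expression), file 1's `QpC` the collapsed sum (second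
expression); `QpC_eq_QpIter` proves they agree (this closes the scope note (ii) of `B7Eq78Linearization`).  Mechanism:
(3.55) peeled from the top (`compT_succ_top`: `U(Γ^{(j+1)}_{y,x}) = Ū^j(Γ_{Ly,x_j})·U(Γ^{(j)}_{x_j,x})`, `x_j ∈ B(Ly)` the
level-`j` ancestor of `x`) and the index split `B^{j+1}(y) = ⋃_{x_j∈B(Ly)} B^j(x_j)`. -/

section Tower

variable {G : Type*} [Group G] (L : ℕ) (W : ℕ → Site d → Fin d → G)

/-- the tower gauge function `B8Eq115GaugeFixing.tg` ([Balaban1985RegularSpaces] (1.15) p.78, p.98) WITHOUT its top factor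
`W_k(Γ_{y,·})`: the product `W_{k−1}(Γ_{Lx_{n−1},x_{n−2}})⋯W_{k−n}(Γ_{Lx_1,x})` of the `n` lower block transporters along the
ancestors `x_i = (fl L)^{[i]}x` of `x` — the lower factors of (3.55). [cite: Balaban1985BackgroundPropagators, (3.55) p.401] -/
def tgS (k : ℕ) : ℕ → Site d → G
  | 0 => fun _ => 1
  | n + 1 => fun x => tgS k n (fl L x) * axialFn (W (k - (n + 1))) ((L : ℤ) • fl L x) x

/-- no lower factor at depth `0`. [cite: Balaban1985BackgroundPropagators, (3.55) p.401] -/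
@[simp] theorem tgS_zero (k : ℕ) (x : Site d) : tgS L W k 0 x = 1 := rfl

/-- the defining recursion (one more lower factor). [cite: Balaban1985BackgroundPropagators, (3.55) p.401] -/
theorem tgS_succ (k n : ℕ) (x : Site d) :
    tgS L W k (n + 1) x = tgS L W k n (fl L x) * axialFn (W (k - (n + 1))) ((L : ℤ) • fl L x) x := rfl

/-- the tower gauge function factors as (top factor at `y`)·(the lower product) — (3.55) read from the left.
[cite: Balaban1985BackgroundPropagators, (3.55) p.401] -/
theorem tg_eq_top_mul (k : ℕ) (y : Site d) : ∀ (n : ℕ) (x : Site d),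
    tg L W k y n x = axialFn (W k) y ((fl L)^[n] x) * tgS L W k n x
  | 0, x => by simp
  | n + 1, x => by
      rw [tg_succ, tg_eq_top_mul k y n (fl L x), iterate_fl_succ, tgS_succ, mul_assoc]

/-- peeling the HIGHEST lower factor: `tgS_{k+1,n+1}(x) = W_k(Γ_{L·x_{n+1},x_n})·tgS_{k,n}(x)`.
[cite: Balaban1985BackgroundPropagators, (3.55) p.401] -/
theorem tgS_succ_top (k : ℕ) : ∀ (n : ℕ) (x : Site d),
    tgS L W (k + 1) (n + 1) x = axialFn (W k) ((L : ℤ) • (fl L)^[n] (fl L x)) ((fl L)^[n] x) * tgS L W k n x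
  | 0, x => by simp [tgS_succ]
  | n + 1, x => by
      rw [tgS_succ, tgS_succ_top k n (fl L x), tgS_succ L W k n x, iterate_fl_succ, iterate_fl_succ,
        show k + 1 - (n + 1 + 1) = k - (n + 1) by omega, mul_assoc]

end Tower

section Collapse

variable (L : ℕ)

/-- **(3.55) peeled from the top**: for `x ∈ B^{j+1}(y)` (`(fl L)^{[j+1]}x = y`) and `x_j = (fl L)^{[j]}x ∈ B(Ly)` its
level-`j` ancestor, `U(Γ^{(j+1)}_{y,x}) = Ū^j(Γ_{Ly,x_j})·U(Γ^{(j)}_{x_j,x})`. [cite: Balaban1985BackgroundPropagators, (3.55) p.401] -/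
theorem compT_succ_top (U : Site d → Fin d → 𝔸ˣ) (j : ℕ) (y x : Site d) (hx : (fl L)^[j + 1] x = y) :
    compT L U (j + 1) y x
      = axialFn (avgIter L U j) ((L : ℤ) • y) ((fl L)^[j] x) * compT L U j ((fl L)^[j] x) x := by
  have hx' : (fl L)^[j] (fl L x) = y := by rwa [iterate_fl_succ] at hx
  rw [compT, compT, tg_eq_top_mul, tg_eq_top_mul, hx, axialFn_self, axialFn_self, one_mul, one_mul,
    tgS_succ_top, hx']

/-- the index split `B^{j+1}(y) = ⋃_{s∈[0,L)^d} B^j(Ly + s)` on offsets: `r = r′ + Lʲs`, `s = r div Lʲ`, `r′ = r mod Lʲ`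
(coordinatewise `finProdFinEquiv`). [cite: Balaban1985BackgroundPropagators, (3.19) p.393] -/
def splitIdx (j : ℕ) : (Fin d → Fin (L ^ (j + 1))) ≃ (Fin d → Fin L) × (Fin d → Fin (L ^ j)) :=
  (Equiv.piCongrRight fun _ : Fin d => (finCongr (pow_succ' L j)).trans finProdFinEquiv.symm).trans
    (Equiv.arrowProdEquivProdArrow (Fin d) (fun _ => Fin L) (fun _ => Fin (L ^ j)))

/-- the sites of `B^{j+1}(y)` re-indexed through `splitIdx`: `L^{j+1}y + r = Lʲ(Ly + s) + r′`.
[cite: Balaban1985BackgroundPropagators, (3.19) p.393] -/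
theorem bsite_split (j : ℕ) (y : Site d) (r : Fin d → Fin (L ^ (j + 1))) :
    bsite L (j + 1) y r = bsite L j (((L : ℤ) • y) + boxVec L (splitIdx L j r).1) (splitIdx L j r).2 := by
  funext i
  -- `r i = r′ i + Lʲ·s i` in `ℕ` (`Nat.mod_add_div`), by `rfl`-unfolding of the equivalences
  have h : (r i : ℕ) = ((splitIdx L j r).2 i : ℕ) + L ^ j * ((splitIdx L j r).1 i : ℕ) :=
    (Nat.mod_add_div (r i : ℕ) (L ^ j)).symm
  have hri : ((r i : ℕ) : ℤ) = (((splitIdx L j r).2 i : ℕ) : ℤ) + (L : ℤ) ^ j * (((splitIdx L j r).1 i : ℕ) : ℤ) := by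
    exact_mod_cast h
  simp only [bsite, Pi.add_apply, Pi.smul_apply, smul_eq_mul, boxVec, hri, pow_succ]
  ring

/-- **(3.19), second equality, PROVED**: `(Q′(Ū^{j−1})·…·Q′(Ū)Q′(U)λ)(y) = Σ_{x∈B^j(y)} L^{−jd}R(U(Γ^{(j)}_{y,x}))λ(x)` — the composite
of the one-step transported block averages (`B9Eq3113Proof.QpIter`) IS the `B^j(y)`-average with the composite contour
transporters (3.55) (file 1's `QpC`). [cite: Balaban1985BackgroundPropagators, (3.19) p.393] -/
theorem QpC_eq_QpIter (hL : 1 ≤ L) (U : Site d → Fin d → 𝔸ˣ) (lam : Site d → 𝔸) :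
    ∀ (j : ℕ) (y : Site d), QpC L U j lam y = B9Eq3113Proof.QpIter L U lam j y
  | 0, y => by
      have hb : ∀ r : Fin d → Fin (L ^ 0), bsite L 0 y r = y := fun r => funext fun i => by
        simp [bsite, boxVec]
      have hterm : ∀ r : Fin d → Fin (L ^ 0),
          ((((L : ℝ) ^ 0) ^ d)⁻¹) • conjR (compT L U 0 y (bsite L 0 y r)) (lam (bsite L 0 y r))
            = lam y := fun r => by
        rw [hb, compT, tg_zero, axialFn_self, B8Ineq132.one_conjR, pow_zero, one_pow, inv_one, one_smul]
      simp_rw [QpC, hterm]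
      rw [Finset.sum_const, Finset.card_univ, Fintype.card_pi_const, Fintype.card_fin, pow_zero, one_pow, one_nsmul,
        B9Eq3113Proof.QpIter_zero]
  | j + 1, y => by
      have hw : ((((L : ℝ) ^ (j + 1)) ^ d)⁻¹) = (((L : ℝ) ^ d)⁻¹) * ((((L : ℝ) ^ j) ^ d)⁻¹) := by
        rw [pow_succ', mul_pow, mul_inv]
      rw [B9Eq3113Proof.QpIter_succ, B9Eq3113Proof.Qp_eq_sum, QpC, ← (splitIdx L j).symm.sum_comp,
        Fintype.sum_prod_type]
      refine Finset.sum_congr rfl fun s _ => ?_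
      rw [← QpC_eq_QpIter hL U lam j, QpC, B8Ineq132.conjR_sum, Finset.smul_sum]
      refine Finset.sum_congr rfl fun r' _ => ?_
      have hsplit : splitIdx L j ((splitIdx L j).symm (s, r')) = (s, r') := Equiv.apply_symm_apply _ _
      set x := bsite L (j + 1) y ((splitIdx L j).symm (s, r')) with hxdef
      have hx : x = bsite L j (((L : ℤ) • y) + boxVec L s) r' := by rw [hxdef, bsite_split, hsplit]
      have hxj : (fl L)^[j] x = ((L : ℤ) • y) + boxVec L s := by rw [hx, iterate_fl_bsite L hL j]
      have hxj1 : (fl L)^[j + 1] x = y := by rw [Function.iterate_succ_apply', hxj, fl_block hL]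
      rw [compT_succ_top L U j y x hxj1, hxj, conjR_mul_left, hw, mul_smul, B7Eq78Linearization.conjR_smul_real, hx]
      simp only [axialFn, add_sub_cancel_left]

end Collapse

end Literature.MathematicalPhysics.QuantumFieldTheory.Balaban1983to89.B9Eq357Levels

end
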